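import Mathlib

/-!
# Route LiouvilleSarnak — crux `LiouvilleCutRank` (stmt-ValiantsHypothesis-14775): NO `2`-ADICALLY PERIODIC SIGN
# PATTERN is compatible with `λ(3) = λ(5) = λ(7) = -1`

The three conductor-`8` twins (`…MultiplicativeBarrier`, `…ModEightBarrier`, `…ModEightBarrierTwo`) are the functions
`(-1)^{v₂(m)} χ(m / 2^{v₂(m)})` with `χ` a real character mod `8`; each reproduces `λ` at two of the primes `3, 5, 7`
and has bounded aligned cut rank.  This file proves the converse obstruction behind the claim "the budget
`{2,3,5,7}` is the first one no `2`-adic twin survives": for `n ≥ 3` there is NO function `s : ℕ → ℤ` that is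
`2^n`-periodic, non-zero at `1`, and satisfies `s(3m) = -s(m)`, `s(5m) = -s(m)`, `s(7m) = -s(m)` for all odd `m`
(★ `no_periodic_sign_three_five_seven`).  Equivalently: no `±1` function on `(ℤ/2^n)ˣ` is flipped by each of the
translations `×3, ×5, ×7` — although `105 = 3·5·7 ≡ 1` only modulo `8`.  The proof produces, for every `n ≥ 3`, an
ODD word `3^a 5^b 7^c ≡ 1 (mod 2^n)` (`exists_odd_word_eq_one_mod`), by lifting `105 ≡ 1 (mod 8)` with the
`2`-adic expansion `5^{2^k} ≡ 1 + 2^{k+2} (mod 2^{k+3})` (`five_pow_two_pow_mod`).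

Use (honest framing): this is the endgame of the intended elementary proof of the relaxed-model hypothesis
`S_{2,3,5,7}` on ALIGNED cuts (`…RelaxedModelBridge`): if a relaxed `g` on `[1,4^n]` were `2^n`-periodic on odd
arguments (as all three twins are, up to the `2`-adic sign), `s(u) = g(u)` would contradict this file; what is
missing for `S_{2,3,5,7}`-aligned is the step "few distinct aligned rows ⟹ `2^j`-periodicity of the odd part",
which is OPEN.  Nothing here is a case of the crux; `LiouvilleCutRank`, `DigitalBilinearLiouville`, `AlgebraicSarnak`
stay OPEN; nothing bears on `VP ≠ VNP`.  No definitions; imports `Mathlib` only.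
-/

set_option linter.dupNamespace false

namespace Summit.ValiantsHypothesis.ValiantsHypothesis.Theorems.LiouvilleSarnakLiouvilleCutRank.NoTwoAdicSignPattern

/-! ### §1 The `2`-adic expansion of powers of `5` -/

/-- `5^{2^k} ≡ 1 + 2^{k+2} (mod 2^{k+3})`: there is `t` with `5^{2^k} = 1 + 2^{k+2} + 2^{k+3} t`. [folklore] -/
theorem five_pow_two_pow_mod (k : ℕ) : ∃ t : ℕ, 5 ^ (2 ^ k) = 1 + 2 ^ (k + 2) + 2 ^ (k + 3) * t := by
  induction k with
  | zero => exact ⟨0, by norm_num⟩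
  | succ k ih =>
    obtain ⟨t, ht⟩ := ih
    -- square: (1 + 2^{k+2} + 2^{k+3} t)^2 = 1 + 2^{k+3} + 2^{k+4} (…)
    refine ⟨2 ^ k + t + 2 ^ (k + 2) * t + 2 ^ (k + 2) * t * t, ?_⟩
    rw [pow_succ, pow_mul, ht]
    ring

/-- Lifting: an odd word `3^a 5^b 7^c ≡ 1 (mod 2^n)` exists for every `n ≥ 3` (`a + b + c` odd).  Base `n = 3`:
`3 · 5 · 7 = 105 ≡ 1 (mod 8)`; step: if the word is `≡ 1 + 2^n (mod 2^{n+1})`, multiply by `5^{2^{n-2}} ≡ 1 + 2^n`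
(an even number of letters). [folklore] -/
theorem exists_odd_word_eq_one_mod (n : ℕ) (hn : 3 ≤ n) :
    ∃ a b c : ℕ, (a + b + c) % 2 = 1 ∧ (3 ^ a * 5 ^ b * 7 ^ c) % 2 ^ n = 1 := by
  induction n, hn using Nat.le_induction with
  | base => exact ⟨1, 1, 1, by norm_num, by norm_num⟩
  | succ n hn ih =>
    obtain ⟨a, b, c, hpar, hmod⟩ := ih
    set w := 3 ^ a * 5 ^ b * 7 ^ c with hw
    -- `w = 1 + 2^n q`
    have hw1 : w % 2 ^ n = 1 := hmod
    obtain ⟨q, hq⟩ : ∃ q, w = 1 + 2 ^ n * q := by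
      refine ⟨w / 2 ^ n, ?_⟩
      have := Nat.div_add_mod w (2 ^ n)
      rw [hw1] at this
      omega
    rcases Nat.even_or_odd q with ⟨r, hr⟩ | ⟨r, hr⟩
    · -- `q` even: already `≡ 1 (mod 2^{n+1})`
      refine ⟨a, b, c, hpar, ?_⟩
      rw [← hw, hq, hr, show 2 ^ n * (r + r) = 2 ^ (n + 1) * r by rw [pow_succ]; ring]
      have h1 : 1 < 2 ^ (n + 1) := Nat.one_lt_two_pow (by omega)
      rw [Nat.add_mul_mod_self_left, Nat.mod_eq_of_lt h1]
    · -- `q` odd: multiply by `5^{2^{n-2}} = 1 + 2^n + 2^{n+1} t`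
      obtain ⟨t, ht⟩ := five_pow_two_pow_mod (n - 2)
      have hn2 : n - 2 + 2 = n := by omega
      have hn3 : n - 2 + 3 = n + 1 := by omega
      rw [hn2, hn3] at ht
      refine ⟨a, b + 2 ^ (n - 2), c, ?_, ?_⟩
      · -- parity: `2^{n-2}` is even for `n ≥ 3`
        have : (2 ^ (n - 2)) % 2 = 0 := by
          obtain ⟨k, hk⟩ : ∃ k, n - 2 = k + 1 := ⟨n - 3, by omega⟩
          rw [hk, pow_succ]; omega
        omega
      · have hprod : 3 ^ a * 5 ^ (b + 2 ^ (n - 2)) * 7 ^ c = w * 5 ^ (2 ^ (n - 2)) := by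
          rw [hw, pow_add]; ring
        rw [hprod, hq, ht, hr]
        -- `(1 + 2^n (2r+1)) (1 + 2^n + 2^{n+1} t) ≡ 1 (mod 2^{n+1})`
        have hexp : (1 + 2 ^ n * (2 * r + 1)) * (1 + 2 ^ n + 2 ^ (n + 1) * t) =
            1 + 2 ^ (n + 1) * (r + 1 + t + 2 ^ n * r * (1 + 2 * t) + 2 ^ (n - 1) * (1 + 2 * t) +
              2 ^ n * r * 0) := by
          have h2n : (2 : ℕ) ^ n = 2 * 2 ^ (n - 1) := by
            rw [← pow_succ']; congr 1; omega
          rw [pow_succ]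
          rw [h2n]
          ring
        rw [hexp]
        have h1 : 1 < 2 ^ (n + 1) := Nat.one_lt_two_pow (by omega)
        rw [Nat.add_mul_mod_self_left, Nat.mod_eq_of_lt h1]

/-! ### §2 No periodic sign pattern flipped by `3`, `5` and `7` -/

/-- Iterating `s(p m) = -s(m)` along a word: `s(3^a 5^b 7^c) = (-1)^{a+b+c} s(1)` when `s` flips under
multiplication of ODD arguments by `3`, `5`, `7`. [folklore] -/
theorem sign_word (s : ℕ → ℤ) (h3 : ∀ m, m % 2 = 1 → s (3 * m) = -s m)
    (h5 : ∀ m, m % 2 = 1 → s (5 * m) = -s m) (h7 : ∀ m, m % 2 = 1 → s (7 * m) = -s m)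
    (a b c : ℕ) : s (3 ^ a * 5 ^ b * 7 ^ c) = (-1) ^ (a + b + c) * s 1 := by
  -- peel the letters one at a time
  have hodd : ∀ a b c : ℕ, (3 ^ a * 5 ^ b * 7 ^ c) % 2 = 1 := by
    intro a b c
    rw [Nat.mul_mod, Nat.mul_mod (3 ^ a), Nat.pow_mod, Nat.pow_mod 5, Nat.pow_mod 7]
    norm_num
  induction a with
  | zero =>
    induction b with
    | zero =>
      induction c with
      | zero => simp
      | succ c ihc =>
        rw [show 3 ^ 0 * 5 ^ 0 * 7 ^ (c + 1) = 7 * (3 ^ 0 * 5 ^ 0 * 7 ^ c) by ring, h7 _ (hodd 0 0 c), ihc]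
        ring
    | succ b ihb =>
      rw [show 3 ^ 0 * 5 ^ (b + 1) * 7 ^ c = 5 * (3 ^ 0 * 5 ^ b * 7 ^ c) by ring, h5 _ (hodd 0 b c), ihb]
      ring
  | succ a iha =>
    rw [show 3 ^ (a + 1) * 5 ^ b * 7 ^ c = 3 * (3 ^ a * 5 ^ b * 7 ^ c) by ring, h3 _ (hodd a b c), iha]
    ring

/-- A `2^n`-periodic function takes the same value at all `m ≡ 1 (mod 2^n)`. [folklore] -/
theorem periodic_apply_of_mod_eq_one (n : ℕ) (s : ℕ → ℤ) (hper : ∀ m, s (m + 2 ^ n) = s m)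
    (w : ℕ) (hw : w % 2 ^ n = 1) : s w = s 1 := by
  have key : ∀ q : ℕ, s (1 + 2 ^ n * q) = s 1 := by
    intro q
    induction q with
    | zero => simp
    | succ q ih => rw [show 1 + 2 ^ n * (q + 1) = (1 + 2 ^ n * q) + 2 ^ n by ring, hper, ih]
  have := Nat.div_add_mod w (2 ^ n)
  rw [hw] at this
  rw [show w = 1 + 2 ^ n * (w / 2 ^ n) by omega]
  exact key _

/-- ★ **No `2`-adically periodic sign pattern is flipped by `3`, `5` and `7`.**  For `n ≥ 3` there is no
`s : ℕ → ℤ` with `s(m + 2^n) = s(m)` for all `m`, `s(1) ≠ 0`, and `s(3m) = -s(m)`, `s(5m) = -s(m)`,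
`s(7m) = -s(m)` for all odd `m`: an odd word `3^a 5^b 7^c ≡ 1 (mod 2^n)` gives `s(1) = -s(1)`. [this file] -/
theorem no_periodic_sign_three_five_seven (n : ℕ) (hn : 3 ≤ n) (s : ℕ → ℤ)
    (hper : ∀ m, s (m + 2 ^ n) = s m) (h1 : s 1 ≠ 0)
    (h3 : ∀ m, m % 2 = 1 → s (3 * m) = -s m) (h5 : ∀ m, m % 2 = 1 → s (5 * m) = -s m)
    (h7 : ∀ m, m % 2 = 1 → s (7 * m) = -s m) : False := by
  obtain ⟨a, b, c, hpar, hmod⟩ := exists_odd_word_eq_one_mod n hn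
  have hA := sign_word s h3 h5 h7 a b c
  have hB := periodic_apply_of_mod_eq_one n s hper _ hmod
  have hneg : (-1 : ℤ) ^ (a + b + c) = -1 := by
    rw [← Nat.div_add_mod (a + b + c) 2, hpar, pow_add, pow_mul]
    norm_num
  rw [hB, hneg] at hA
  have : s 1 = 0 := by linarith
  exact h1 this

/-- **The `±1`-form on residues.**  For `n ≥ 3` there is no `h : ℕ → ℤ` with `h(1) = 1 ∨ h(1) = -1` such that
`h` depends only on `m mod 2^n` and `h((p m) mod 2^n) = -h(m mod 2^n)`-style flips hold for `p = 3, 5, 7` on odd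
`m` — stated as: no `2^n`-periodic `h` with `h 1 = ±1` flipped by `3, 5, 7` on odd arguments. [this file] -/
theorem no_periodic_pm_one_three_five_seven (n : ℕ) (hn : 3 ≤ n) (h : ℕ → ℤ)
    (hper : ∀ m, h (m + 2 ^ n) = h m) (h1 : h 1 = 1 ∨ h 1 = -1)
    (h3 : ∀ m, m % 2 = 1 → h (3 * m) = -h m) (h5 : ∀ m, m % 2 = 1 → h (5 * m) = -h m)
    (h7 : ∀ m, m % 2 = 1 → h (7 * m) = -h m) : False :=
  no_periodic_sign_three_five_seven n hn h hper (by rcases h1 with h1 | h1 <;> rw [h1] <;> norm_num) h3 h5 h7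

end Summit.ValiantsHypothesis.ValiantsHypothesis.Theorems.LiouvilleSarnakLiouvilleCutRank.NoTwoAdicSignPattern
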